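import Summits.ValiantsHypothesis.ValiantsHypothesis.Theorems.LacunarySymmetroidMatrixDescartesVSQTriLaw
import Summits.ValiantsHypothesis.ValiantsHypothesis.Theorems.LacunarySymmetroidMatrixDescartesCensusM3K4F18
import Summits.ValiantsHypothesis.ValiantsHypothesis.Theorems.LacunarySymmetroidMatrixDescartesCensusRowLawM5

/-!
# `MatrixDescartes` census — THE SMALL-`m` SUPER-`P` LAW: `ζ_sym(m,K) > P(m,K)` for EVERY `2 ≤ m ≤ 5` and EVERY `K ≥ 4`

HONEST FRAMING.  Experiment cell `val-V1-extremal`, width seat val-v1x-eng-9 g3 (`--supports stmt-ValiantsHypothesis-18050 --as helper`).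
One bookkeeping theorem over rows ALREADY in the tree; LOWER-bound census (CONJECTURE-A) currency.  It proves NOTHING about the crux
`Theses.LacunarySymmetroid.MatrixDescartes` (stmt-ValiantsHypothesis-18050: an UPPER bound `2^{C K log K}` at fat formats `K^{1+o(1)} ≤ m ≤ 2^{polylog K}` —
the rows here are polynomial in `K` at FIXED `m ≤ 5`, outside that window for large `K`), nothing about `DoorA26` / `DoorA34`, nothing about
`VP ≠ VNP`; VP ≠ VNP is NOT proved.  No definitions, no `sorry`.

THE STATEMENT (`superP_small`).  With `P(m,K) = K·m(m+1)/2 − m²` the parameter count of the format `(m,K)` (the cell's GRID column `P`;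
`MatrixDescartesWitness24.not_dimensionLaw_two_four` is the first cell `(2,4)` where `ζ > P` was certified):

  **for all `m, K` with `2 ≤ m ≤ 5`, `4 ≤ K`:  `¬ PosRootLawAt m K (K·(m(m+1)/2) − m²)`,  i.e.  `ζ_sym(m,K) ≥ P(m,K) + 1`.**

Rows used: `m = 2` — val-v1x-eng-6's `VSQ.vsq_law` (`4K − 7 ≥ 3K − 3`); `m = 3` — `VSQ.tri_law_three` (`7K − 13 ≥ 6K − 8` for `K ≥ 5`) and the census
row `M3K4F18.not_posRootLawAt` (`(3,4) ≥ 18 > 15`); `m = 4` — `RowLawM4.rowLaw` (periodic `CAPF30` block ladder, excess `6/3/1`); `m = 5` —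
`RowLawM5.rowLaw` (periodic `ENDBOTH61` block ladder, slope `61/4 > 15`, unbounded excess).  READING for the cell's table (numbers, not adjectives):
every format-row `m ≤ 5` of the census beats the parameter count at every `K ≥ 4` by kernel theorems; `m = 1` cannot (`ζ(1,K) = K − 1 = P = D`,
Descartes); for `m ≥ 6` every atom of record has `K`-slope below the `P`-slope `m(m+1)/2` (`ENDBOTH75`: `18.75 < 21`, `ENDBOTH104`: `26 < 28`,
`QF83`: `27.7 < 36`), so the located rows fall BELOW `P` for large `K` there and no such law is claimed — whether `ζ_sym(m,K) > P(m,K)` persists for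
`m ≥ 6` is exactly the cell's open «P-tracking» question (val-v1x-eng-7 g3 GROWTH-v2 §3: one atom at `T(m,K_F) = P + (m² − m)/2` per row would settle it).
Credits as in the row files (eng-6 VSQ laws; eng-1 / eng-2 g2 / eng-9 g2 atoms; eng-8 g3 block kit; val-sym-mdr-p1 chain calculus; pub-symmetroid census).
[folklore] (bookkeeping).
-/

-- `Summit.ValiantsHypothesis.ValiantsHypothesis.…` repeats a component by the D-0017 layout
-- (single-conjunct summit), which the `dupNamespace` linter flags; the name is mandated.
set_option linter.dupNamespace false

namespace Summit.ValiantsHypothesis.ValiantsHypothesis.Theorems.LacunarySymmetroidMatrixDescartes.Census.Reflect.SuperPSmallM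

open Summit.ValiantsHypothesis.ValiantsHypothesis.Theorems.MatrixDescartes.Negative (PosRootLawAt)
open Summit.ValiantsHypothesis.ValiantsHypothesis.Theorems.LacunarySymmetroidMatrixDescartes
open Summit.ValiantsHypothesis.ValiantsHypothesis.Theorems.LacunarySymmetroidMatrixDescartes.Census
open Summit.ValiantsHypothesis.ValiantsHypothesis.Theorems.LacunarySymmetroidMatrixDescartes.Census.Reflect
open Summit.ValiantsHypothesis.ValiantsHypothesis.Theorems.LacunarySymmetroidMatrixDescartes.Census.Reflect.RowLawM4 (mono)

/-- **THE SMALL-`m` SUPER-`P` LAW.**  For every `2 ≤ m ≤ 5` and every `K ≥ 4` some real symmetric `K`-letter `m × m` lacunary pencil has MORE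
distinct positive determinant roots than the parameter count `P(m,K) = K·m(m+1)/2 − m²`:  `¬ PosRootLawAt m K (K·(m(m+1)/2) − m²)`.
LOWER-bound census currency; nothing about the crux `MatrixDescartes`. [folklore] -/
theorem superP_small (m K : ℕ) (hm : 2 ≤ m) (hm' : m ≤ 5) (hK : 4 ≤ K) :
    ¬ PosRootLawAt m K (K * (m * (m + 1) / 2) - m ^ 2) := by
  interval_cases m
  · -- `m = 2`: `P = 3K − 4`; eng-6's VSQ law `ζ(2,K) ≥ 4K − 7`
    show ¬ PosRootLawAt 2 K (K * 3 - 4)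
    exact mono (VSQ.vsq_law K hK) (by omega)
  · -- `m = 3`: `P = 6K − 9`; `(3,4) ≥ 18`, and eng-6's `ζ(3,K) ≥ 7K − 13` for `K ≥ 5`
    show ¬ PosRootLawAt 3 K (K * 6 - 9)
    rcases Nat.lt_or_ge K 5 with h5 | h5
    · obtain rfl : K = 4 := by omega
      exact mono M3K4F18.not_posRootLawAt (by norm_num)
    · exact mono (VSQ.tri_law_three K hK) (by omega)
  · -- `m = 4`: `P = 10K − 16`
    show ¬ PosRootLawAt 4 K (K * 10 - 16)
    exact mono (RowLawM4.rowLaw K hK) (by omega)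
  · -- `m = 5`: `P = 15K − 25`
    show ¬ PosRootLawAt 5 K (K * 15 - 25)
    exact mono (RowLawM5.rowLaw K hK) (by omega)

/-- The same with the parameter count spelled per row: `P(2,K) = 3K − 4`, `P(3,K) = 6K − 9`, `P(4,K) = 10K − 16`, `P(5,K) = 15K − 25`
(a restatement for readers of the GRID; `m(m+1)/2 ∈ {3, 6, 10, 15}`). [folklore] -/
theorem superP_small' (K : ℕ) (hK : 4 ≤ K) :
    ¬ PosRootLawAt 2 K (3 * K - 4) ∧ ¬ PosRootLawAt 3 K (6 * K - 9) ∧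
      ¬ PosRootLawAt 4 K (10 * K - 16) ∧ ¬ PosRootLawAt 5 K (15 * K - 25) := by
  have h2 : ¬ PosRootLawAt 2 K (K * 3 - 4) := superP_small 2 K (by norm_num) (by norm_num) hK
  have h3 : ¬ PosRootLawAt 3 K (K * 6 - 9) := superP_small 3 K (by norm_num) (by norm_num) hK
  have h4 : ¬ PosRootLawAt 4 K (K * 10 - 16) := superP_small 4 K (by norm_num) (by norm_num) hK
  have h5 : ¬ PosRootLawAt 5 K (K * 15 - 25) := superP_small 5 K (by norm_num) (by norm_num) hK
  exact ⟨mono h2 (by omega), mono h3 (by omega), mono h4 (by omega), mono h5 (by omega)⟩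

end Summit.ValiantsHypothesis.ValiantsHypothesis.Theorems.LacunarySymmetroidMatrixDescartes.Census.Reflect.SuperPSmallM
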